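import Summits.Parity.GeneralizedHardyLittlewood.Theorems.ChenParityOracleBLAPHostParityFromBrickRankinSparse
import Literature.NumberTheory.Sieve.DivisorPowerSums
import HarnessLib

/-!
# Route `ChenParityOracleBLAP` — crux S1 = `HostParityFromBrick` (stmt-Parity-20045): divisor-weighted sum over the sparse set

Support file for the prime half `K1 → K2 → HP1` of S1, sifting step (S): the tail of the truncated
sifting identity, summed over the outer variable and over the moduli `d`, is
`≤ ∑_{k ≤ u, k has an N-smooth divisor ≥ x^{ε_T}} τ(k)² τ(k+2)`.  By Cauchy–Schwarz, the
divisor power moments `∑ τ^8 ≪ x (log x)^{512}`, `∑ τ^4 ≪ x (log x)^{32}` (tree,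
`Literature.NumberTheory.Sieve.exists_sum_sigma_zero_pow_le_real`) and the sparse-set bound
(`card_largeSmoothDivisor_le` with `c` large) this is `≤ K x/(log x)^{A+1}` as soon as
`2c ≤ log N ≤ 2 log x/log log x` (`sparse_tau_sum_le`).

References: G. Tenenbaum, *Introduction to Analytic and Probabilistic Number Theory* (2015),
Ch. III.5 [Tenenbaum2015].
-/

namespace Summit.Parity.GeneralizedHardyLittlewood.Theorems

open Finset Real
open scoped ArithmeticFunction.sigma
open ArithmeticFunction (sigma)

/-- Cauchy–Schwarz + AM–GM: for `S ⊆ [1,u]`,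
`∑_{k∈S} τ(k)² τ(k+2) ≤ √#S · √(∑_{k ≤ u} τ(k)^8 + ∑_{n ≤ u+2} τ(n)^4)`. -/
theorem sum_sparse_tau_le_sqrt {S : Finset ℕ} {u : ℕ} (hS : S ⊆ Icc 1 u) :
    ∑ k ∈ S, ((σ 0 k : ℝ) ^ 2 * (σ 0 (k + 2) : ℝ)) ≤
      Real.sqrt #S * Real.sqrt (∑ k ∈ Icc 1 u, (σ 0 k : ℝ) ^ 8 +
        ∑ n ∈ Icc 1 (u + 2), (σ 0 n : ℝ) ^ 4) := by
  have hcs := Real.sum_mul_le_sqrt_mul_sqrt S (fun _ => (1 : ℝ))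
    (fun k => (σ 0 k : ℝ) ^ 2 * (σ 0 (k + 2) : ℝ))
  simp only [one_mul, one_pow, Finset.sum_const, nsmul_eq_mul, mul_one] at hcs
  refine hcs.trans (mul_le_mul_of_nonneg_left (Real.sqrt_le_sqrt ?_) (Real.sqrt_nonneg _))
  -- `a_k² ≤ τ(k)^8 + τ(k+2)^4` and extend to `[1,u]`
  have h1 : ∑ k ∈ S, ((σ 0 k : ℝ) ^ 2 * (σ 0 (k + 2) : ℝ)) ^ 2 ≤
      ∑ k ∈ Icc 1 u, (((σ 0 k : ℝ) ^ 8) + (σ 0 (k + 2) : ℝ) ^ 4) := by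
    refine (Finset.sum_le_sum_of_subset_of_nonneg hS fun k _ _ => sq_nonneg _).trans
      (Finset.sum_le_sum fun k _ => ?_)
    have : ((σ 0 k : ℝ) ^ 2 * (σ 0 (k + 2) : ℝ)) ^ 2 = ((σ 0 k : ℝ) ^ 4) * (σ 0 (k + 2) : ℝ) ^ 2 := by
      ring
    rw [this]
    nlinarith [sq_nonneg (((σ 0 k : ℝ) ^ 4) - (σ 0 (k + 2) : ℝ) ^ 2)]
  refine h1.trans ?_
  rw [Finset.sum_add_distrib]
  gcongr
  -- `∑_{k ≤ u} τ(k+2)^4 ≤ ∑_{n ≤ u+2} τ(n)^4`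
  have hinj : Set.InjOn (fun k : ℕ => k + 2) (Icc 1 u : Set ℕ) := fun a _ b _ h => by simpa using h
  rw [← Finset.sum_image (f := fun n => (σ 0 n : ℝ) ^ 4) hinj]
  refine Finset.sum_le_sum_of_subset_of_nonneg ?_ fun n _ _ => by positivity
  intro n hn
  rw [Finset.mem_image] at hn
  obtain ⟨k, hk, rfl⟩ := hn
  rw [Finset.mem_Icc] at hk ⊢; omega

/-- **The divisor-weighted sparse-set sum.**  For `A, ε_T > 0` there are `K, c > 0` such that for
all `x ≥ 16`, `u ≤ x`, `3 ≤ N ≤ x` with `2c ≤ log N ≤ 2 log x/log log x`: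
`∑_{k ≤ u : ∃ e ∣ k, e N-smooth, e ≥ x^{ε_T}} τ(k)² τ(k+2) ≤ K x/(log x)^{A+1}`
[cite: Tenenbaum2015, Chapter III.5]. -/
theorem sparse_tau_sum_le (A εT : ℝ) (hA : 0 < A) (hεT : 0 < εT) :
    ∃ K c : ℝ, 0 < K ∧ 0 < c ∧ ∀ x u N : ℕ, (16 : ℝ) ≤ x → u ≤ x → 3 ≤ N → (N : ℝ) ≤ x →
      2 * c ≤ Real.log N → Real.log N ≤ 2 * Real.log x / Real.log (Real.log x) →
      ∑ k ∈ (Icc 1 u).filter (fun k => ∃ e ∈ k.divisors, e ∈ Nat.smoothNumbers N ∧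
          (x : ℝ) ^ εT ≤ (e : ℝ)), ((σ 0 k : ℝ) ^ 2 * (σ 0 (k + 2) : ℝ)) ≤
        K * x / Real.log x ^ (A + 1) := by
  classical
  obtain ⟨C₈, hC₈, h8⟩ := Literature.NumberTheory.Sieve.exists_sum_sigma_zero_pow_le_real 8
  obtain ⟨C₄, hC₄, h4⟩ := Literature.NumberTheory.Sieve.exists_sum_sigma_zero_pow_le_real 4
  -- the Rankin parameter: `εT c / 2 = 520 + 2A`
  set c : ℝ := 2 * (520 + 2 * A) / εT with hc
  have hc0 : 0 < c := by rw [hc]; positivity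
  set Kc : ℝ := Real.exp (4 * (4 + 3 * (Real.exp c - 1))) with hKc
  set K : ℝ := Real.sqrt Kc * Real.sqrt (C₈ + 2 ^ 33 * C₄) with hK
  have hKc0 : 0 < Kc := Real.exp_pos _
  have hK0 : 0 < K := by rw [hK]; positivity
  refine ⟨K, c, hK0, hc0, ?_⟩
  intro x u N hx hu hN hNx hcN hNhi
  have hx1 : (1 : ℝ) < x := by linarith
  have hx0 : (0 : ℝ) < x := by linarith
  have hx2 : (2 : ℝ) ≤ x := by linarith
  have hlogx : 1 < Real.log x := by
    rw [← Real.log_exp 1]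
    refine Real.log_lt_log (Real.exp_pos 1) ?_
    have := Real.exp_one_lt_d9; linarith
  have hlogx0 : 0 < Real.log x := by linarith
  have hllx : 0 < Real.log (Real.log x) := Real.log_pos hlogx
  have hN3 : (3 : ℝ) ≤ N := by exact_mod_cast hN
  have hlogN : 0 < Real.log N := Real.log_pos (by linarith)
  have hlogNx : Real.log N ≤ Real.log x := Real.log_le_log (by linarith) hNx
  set S := (Icc 1 u).filter (fun k => ∃ e ∈ k.divisors, e ∈ Nat.smoothNumbers N ∧
    (x : ℝ) ^ εT ≤ (e : ℝ)) with hSdef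
  -- Step 1: the sparse set
  have hY : (1 : ℝ) ≤ (x : ℝ) ^ εT := Real.one_le_rpow hx1.le hεT.le
  have hσ : c / Real.log N ≤ 1 / 2 := by
    rw [div_le_iff₀ hlogN]; linarith
  have hcard := card_largeSmoothDivisor_le (by omega : 2 ≤ N) u hY hc0.le hσ
  -- `(x^εT)^{-c/log N} ≤ (log x)^{-(520 + 2A)}`
  have hYpow : ((x : ℝ) ^ εT) ^ (-(c / Real.log N)) ≤ Real.log x ^ (-(520 + 2 * A)) := by
    rw [← Real.rpow_mul hx0.le, Real.rpow_def_of_pos hx0, Real.rpow_def_of_pos hlogx0]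
    refine Real.exp_le_exp.2 ?_
    -- `log x · (εT · (-(c/log N))) ≤ log log x · (-(520+2A))`
    have h1 : Real.log (Real.log x) / 2 ≤ Real.log x / Real.log N := by
      rw [div_le_div_iff₀ (by norm_num) hlogN]
      calc Real.log (Real.log x) * Real.log N
          ≤ Real.log (Real.log x) * (2 * Real.log x / Real.log (Real.log x)) :=
            mul_le_mul_of_nonneg_left hNhi hllx.le
        _ = Real.log x * 2 := by field_simp
    have h2 : Real.log x * (εT * (-(c / Real.log N))) = -(εT * c) * (Real.log x / Real.log N) := by
      ring
    rw [h2]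
    have h3 : εT * c = 2 * (520 + 2 * A) := by rw [hc]; field_simp
    rw [h3]
    nlinarith [h1, hllx]
  have hexpN : Real.exp (4 * (Real.log (Real.log N) + 4 + 3 * (Real.exp c - 1))) =
      Real.log N ^ 4 * Kc := by
    rw [hKc, show 4 * (Real.log (Real.log N) + 4 + 3 * (Real.exp c - 1)) =
      (4 : ℕ) * Real.log (Real.log N) + 4 * (4 + 3 * (Real.exp c - 1)) by push_cast; ring,
      Real.exp_add, Real.exp_nat_mul, Real.exp_log hlogN]
  have hcardle : (#S : ℝ) ≤ x * (Real.log x ^ (-(520 + 2 * A)) * (Real.log x ^ 4 * Kc)) := by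
    refine hcard.trans ?_
    rw [hexpN]
    have hux : (u : ℝ) ≤ x := by exact_mod_cast hu
    have hl4 : Real.log N ^ 4 ≤ Real.log x ^ 4 := by gcongr
    calc (u : ℝ) * (((x : ℝ) ^ εT) ^ (-(c / Real.log N)) * (Real.log N ^ 4 * Kc))
        ≤ x * (((x : ℝ) ^ εT) ^ (-(c / Real.log N)) * (Real.log N ^ 4 * Kc)) :=
          mul_le_mul_of_nonneg_right hux (by positivity)
      _ ≤ x * (Real.log x ^ (-(520 + 2 * A)) * (Real.log x ^ 4 * Kc)) := by
          refine mul_le_mul_of_nonneg_left ?_ hx0.le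
          exact mul_le_mul hYpow (mul_le_mul_of_nonneg_right hl4 hKc0.le) (by positivity)
            (by positivity)
  -- Step 2: divisor moments
  have hM8 : ∑ k ∈ Icc 1 u, (σ 0 k : ℝ) ^ 8 ≤ C₈ * x * Real.log x ^ (2 ^ 9 : ℕ) := by
    have h := h8 x hx2
    rw [Nat.floor_natCast] at h
    exact (Finset.sum_le_sum_of_subset_of_nonneg (Finset.Icc_subset_Icc_right hu)
      fun k _ _ => by positivity).trans h
  have hM4 : ∑ n ∈ Icc 1 (u + 2), (σ 0 n : ℝ) ^ 4 ≤ 2 ^ 33 * C₄ * x * Real.log x ^ (2 ^ 9 : ℕ) := by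
    have hx2' : (2 : ℝ) ≤ ((x + 2 : ℕ) : ℝ) := by push_cast; linarith
    have h := h4 ((x + 2 : ℕ) : ℝ) hx2'
    rw [Nat.floor_natCast] at h
    refine (Finset.sum_le_sum_of_subset_of_nonneg (Finset.Icc_subset_Icc_right (by omega))
      fun k _ _ => by positivity).trans (h.trans ?_)
    -- `C₄ (x+2) (log(x+2))^32 ≤ 2^33 C₄ x (log x)^512`
    have hl2 : Real.log ((x + 2 : ℕ) : ℝ) ≤ 2 * Real.log x := by
      push_cast
      have : (x : ℝ) + 2 ≤ (x : ℝ) ^ 2 := by nlinarith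
      calc Real.log ((x : ℝ) + 2) ≤ Real.log ((x : ℝ) ^ 2) := Real.log_le_log (by positivity) this
        _ = 2 * Real.log x := by rw [Real.log_pow]; push_cast; ring
    have hl0 : 0 ≤ Real.log ((x + 2 : ℕ) : ℝ) := Real.log_nonneg (by push_cast; linarith)
    have hpow : Real.log ((x + 2 : ℕ) : ℝ) ^ (2 ^ 5 : ℕ) ≤ (2 * Real.log x) ^ (2 ^ 5 : ℕ) :=
      pow_le_pow_left₀ hl0 hl2 _
    have hpow' : (2 * Real.log x) ^ (2 ^ 5 : ℕ) ≤ 2 ^ 32 * Real.log x ^ (2 ^ 9 : ℕ) := by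
      rw [mul_pow]
      have : Real.log x ^ (2 ^ 5 : ℕ) ≤ Real.log x ^ (2 ^ 9 : ℕ) :=
        pow_le_pow_right₀ hlogx.le (by norm_num)
      norm_num at this ⊢; linarith
    have hx2x : ((x + 2 : ℕ) : ℝ) ≤ 2 * x := by push_cast; linarith
    calc C₄ * ((x + 2 : ℕ) : ℝ) * Real.log ((x + 2 : ℕ) : ℝ) ^ (2 ^ (4 + 1))
        ≤ C₄ * (2 * x) * (2 ^ 32 * Real.log x ^ (2 ^ 9 : ℕ)) := by
          refine mul_le_mul (mul_le_mul_of_nonneg_left hx2x hC₄.le) (hpow.trans hpow') (by positivity)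
            (by positivity)
      _ = 2 ^ 33 * C₄ * x * Real.log x ^ (2 ^ 9 : ℕ) := by ring
  -- Step 3: combine
  have hsqrt := sum_sparse_tau_le_sqrt (S := S) (u := u) (Finset.filter_subset _ _)
  refine hsqrt.trans ?_
  have hA1 : Real.sqrt (#S : ℝ) ≤ Real.sqrt (x * (Real.log x ^ (-(520 + 2 * A)) * (Real.log x ^ 4 * Kc))) :=
    Real.sqrt_le_sqrt hcardle
  have hB1 : Real.sqrt (∑ k ∈ Icc 1 u, (σ 0 k : ℝ) ^ 8 + ∑ n ∈ Icc 1 (u + 2), (σ 0 n : ℝ) ^ 4) ≤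
      Real.sqrt ((C₈ + 2 ^ 33 * C₄) * x * Real.log x ^ (2 ^ 9 : ℕ)) :=
    Real.sqrt_le_sqrt (by nlinarith [hM8, hM4])
  refine (mul_le_mul hA1 hB1 (Real.sqrt_nonneg _) (Real.sqrt_nonneg _)).trans ?_
  -- `√(x L^{-(520+2A)} L^4 Kc) √((C₈+2^33 C₄) x L^512) = K x L^{(−516−2A+512)/2} = K x/L^{A+2} ≤ K x/L^{A+1}`
  have hL4 : Real.log x ^ (4 : ℕ) = Real.log x ^ (4 : ℝ) := by
    rw [show (4 : ℝ) = ((4 : ℕ) : ℝ) by norm_num, Real.rpow_natCast]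
  have hL512 : Real.log x ^ (2 ^ 9 : ℕ) = Real.log x ^ (512 : ℝ) := by
    rw [show (512 : ℝ) = ((2 ^ 9 : ℕ) : ℝ) by norm_num, Real.rpow_natCast]
  have hprod : x * (Real.log x ^ (-(520 + 2 * A)) * (Real.log x ^ 4 * Kc)) *
      ((C₈ + 2 ^ 33 * C₄) * x * Real.log x ^ (2 ^ 9 : ℕ)) =
      (Kc * (C₈ + 2 ^ 33 * C₄)) * (x / Real.log x ^ (A + 2)) ^ 2 := by
    have e1 : Real.log x ^ (-(520 + 2 * A)) * Real.log x ^ (4 : ℝ) * Real.log x ^ (512 : ℝ) *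
        (Real.log x ^ (A + 2)) ^ 2 = 1 := by
      rw [← Real.rpow_mul_natCast hlogx0.le, ← Real.rpow_add hlogx0, ← Real.rpow_add hlogx0,
        ← Real.rpow_add hlogx0,
        show -(520 + 2 * A) + 4 + 512 + (A + 2) * ((2 : ℕ) : ℝ) = 0 by push_cast; ring,
        Real.rpow_zero]
    have hM : Real.log x ^ (-(520 + 2 * A)) * Real.log x ^ (4 : ℝ) * Real.log x ^ (512 : ℝ) =
        ((Real.log x ^ (A + 2)) ^ 2)⁻¹ := eq_inv_of_mul_eq_one_left e1
    rw [hL4, hL512, div_pow]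
    calc (x : ℝ) * (Real.log x ^ (-(520 + 2 * A)) * (Real.log x ^ (4 : ℝ) * Kc)) *
          ((C₈ + 2 ^ 33 * C₄) * x * Real.log x ^ (512 : ℝ))
        = Kc * (C₈ + 2 ^ 33 * C₄) * (x : ℝ) ^ 2 *
          (Real.log x ^ (-(520 + 2 * A)) * Real.log x ^ (4 : ℝ) * Real.log x ^ (512 : ℝ)) := by ring
      _ = Kc * (C₈ + 2 ^ 33 * C₄) * (x : ℝ) ^ 2 * ((Real.log x ^ (A + 2)) ^ 2)⁻¹ := by rw [hM]
      _ = Kc * (C₈ + 2 ^ 33 * C₄) * ((x : ℝ) ^ 2 / (Real.log x ^ (A + 2)) ^ 2) := by ring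
  rw [← Real.sqrt_mul (by positivity), hprod, Real.sqrt_mul (by positivity),
    Real.sqrt_sq (by positivity), hK, ← Real.sqrt_mul hKc0.le]
  -- `√(Kc C) · x/L^{A+2} ≤ √(Kc C) · x/L^{A+1}`
  have hden : Real.log x ^ (A + 1) ≤ Real.log x ^ (A + 2) :=
    Real.rpow_le_rpow_of_exponent_le hlogx.le (by linarith)
  rw [mul_div_assoc]
  exact mul_le_mul_of_nonneg_left (div_le_div_of_nonneg_left hx0.le
    (Real.rpow_pos_of_pos hlogx0 _) hden) (Real.sqrt_nonneg _)

end Summit.Parity.GeneralizedHardyLittlewood.Theorems
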